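import Mathlib
import Literature.AlgebraicGeometry.Resolution.LocalBlowup
import Literature.AlgebraicGeometry.Resolution.LocalUniformization
import Literature.AlgebraicGeometry.Resolution.CentreLocalRingLemmas
import Literature.AlgebraicGeometry.Resolution.RankOneReductionProofs
import Literature.RingTheory.KrullDimension.AffineCatenary
import Summits.ResolutionOfSingularities.ResolutionOfSingularities.Theorems.HomologicalConductorStrictDropTowerDimAntitone
import HarnessLib

/-!
# Crux `StrictDrop` (stmt-ResolutionOfSingularities-16485), line `birth` — along a RESIDUALLY ALGEBRAIC
# («zero-dimensional») valuation every stage of the canonical tower has dimension `dim A = tr.deg_k K`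

Route `ResolutionOfSingularities/HomologicalConductor`, crux #4 `StrictDrop`; Birth vocabulary `NoZeno.Birth.tower`.
OURS (cell decomp-res, hand leafhand-res-homologicalconduct-3); AI-written support lemmas, weaker than expert review;
nothing here is a statement of any manuscript under review.  SUPPORT-level (companion of
`HomologicalConductorStrictDropTowerDimAntitone`, p798979); no stub, crux, route or summit statement is proved here.

* `isMaximal_centreIdeal_of_residuallyAlgebraic` — if every element of `O` is algebraic over `k` modulo `𝔪_O`
  (hypothesis carried pointwise: `∀ x ∈ O, ∃ f ≠ 0, v(f(x)) > 0`; i.e. the residue field of `O` is algebraic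
  over `k`), then the centre of `O` on any `k`-subalgebra `B ⊆ O` is a maximal ideal.
* `ringKrullDim_tower_eq_of_residuallyAlgebraic` — hence `dim T_m = dim A` for every stage: the terminal
  dimension of the tower (`exists_ringKrullDim_tower_eventually_eq`) along such `O` is `tr.deg_k K`, so the
  terminal-dimension-two slice of the kernel `stub_dichotomy_dimGETwo` along zero-dimensional valuations is
  exactly the kill-test regime `dim A = 2` (`HomologicalConductorStrictDropOfSurfaceTermination`, p799166), and in
  `tr.deg_k K ≥ 3` every stage along them keeps dimension `tr.deg_k K`; positive residue transcendence degree is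
  where the terminal dimension can be smaller than `tr.deg_k K` (re-grounding over a lift of a transcendence basis
  of the residue field is the natural next step; not done here).

References (mechanism only): H. Matsumura, *Commutative Ring Theory*, Thm. 5.6 [`Matsumura1987`].
-/

noncomputable section

-- single-problem summit: the doubled namespace component `ResolutionOfSingularities` is forced
set_option linter.dupNamespace false

open IsLocalRing
open Literature.AlgebraicGeometry.Resolution

namespace Summit.ResolutionOfSingularities.ResolutionOfSingularities.Theorems.NoZeno.Birth

variable {k K : Type} [Field k] [Field K] [Algebra k K]

/-- **The centre of a RESIDUALLY ALGEBRAIC valuation on a finitely generated model is a closed point.**  If every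
element of `O` is algebraic over `k` modulo `𝔪_O` (the residue field of `O` is algebraic over `k` — a
«zero-dimensional» valuation), then for a `k`-subalgebra `B ⊆ O` of `K` the centre `𝔪_O ∩ B` is a maximal ideal:
`B/(𝔪_O ∩ B)` is a domain algebraic over the field `k`, hence a field. [folklore] -/
theorem isMaximal_centreIdeal_of_residuallyAlgebraic (O : ValuationSubring K) (B : Subalgebra k K)
    (hBO : B.toSubring ≤ O.toSubring)
    (hres : ∀ x : K, x ∈ O → ∃ f : Polynomial k, f ≠ 0 ∧ O.valuation (Polynomial.aeval x f) < 1) :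
    (centreIdeal B O hBO).IsMaximal := by
  -- every element of `B ⧸ 𝔮` is algebraic over `k`
  haveI : Algebra.IsAlgebraic k (↥B ⧸ centreIdeal B O hBO) := by
    refine ⟨fun y => ?_⟩
    obtain ⟨x, rfl⟩ := Ideal.Quotient.mk_surjective y
    obtain ⟨f, hf0, hfv⟩ := hres (x : K) (hBO x.2)
    refine ⟨f, hf0, ?_⟩
    have hmem : (Polynomial.aeval x f : ↥B) ∈ centreIdeal B O hBO := by
      rw [mem_centreIdeal_iff]
      have h : ((Polynomial.aeval x f : ↥B) : K) = Polynomial.aeval (x : K) f :=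
        (Polynomial.aeval_algebraMap_apply K x f).symm
      rw [h]
      exact hfv
    rw [← Ideal.Quotient.algebraMap_eq, Polynomial.aeval_algebraMap_apply,
      Ideal.Quotient.algebraMap_eq, Ideal.Quotient.eq_zero_iff_mem]
    exact hmem
  haveI : Algebra.IsIntegral k (↥B ⧸ centreIdeal B O hBO) := Algebra.IsAlgebraic.isIntegral
  have hinj : Function.Injective (algebraMap k (↥B ⧸ centreIdeal B O hBO)) :=
    (algebraMap k (↥B ⧸ centreIdeal B O hBO)).injective
  have hF : IsField (↥B ⧸ centreIdeal B O hBO) :=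
    (Algebra.IsIntegral.isField_iff_isField hinj).mp (Field.toIsField k)
  exact Ideal.Quotient.maximal_of_isField _ hF

/-- **Along a residually algebraic valuation every stage of the canonical tower has the dimension of `A`**
(`= tr.deg_k K`): the centre of `O` on a finitely generated model `A_m` of `T_m` is a closed point
(`isMaximal_centreIdeal_of_residuallyAlgebraic`), so `dim T_m = ht (𝔪_O ∩ A_m) = dim A_m` (affine dimension
formula `dim A_m/𝔮 + ht 𝔮 = dim A_m`, tree `Literature.RingTheory.KrullDimension.ringKrullDim_quotient_add_height`)
`= tr.deg_k K = dim A`.  So for «zero-dimensional» valuations the terminal dimension of the tower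
(`exists_ringKrullDim_tower_eventually_eq`) is `tr.deg_k K`: the dimension-two slice of the kernel of crux
`StrictDrop` along them is exactly the regime `dim A = 2` of the kill test `SurfaceTermination`
(`HomologicalConductorStrictDropOfSurfaceTermination`). [cite: Matsumura1987, Thm. 5.6] [folklore] -/
theorem ringKrullDim_tower_eq_of_residuallyAlgebraic (O : ValuationSubring K) (A : Subalgebra k K)
    (hA : A.FG) (hfr : IsFractionRing ↥A K) (hAO : A.toSubring ≤ O.toSubring)
    (hres : ∀ x : K, x ∈ O → ∃ f : Polynomial k, f ≠ 0 ∧ O.valuation (Polynomial.aeval x f) < 1)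
    (m : ℕ) : ringKrullDim ↥(tower O A m) = ringKrullDim ↥A := by
  haveI := hfr
  obtain ⟨Am, hAmfg, hAAm, hAmO, hT⟩ := exists_fg_model_tower O A hA hfr hAO m
  rw [ringKrullDim_tower_eq_height_centre O A m hAmO hT]
  -- the centre is maximal, so its height is `dim Am`
  haveI : Algebra.FiniteType k ↥Am := Am.fg_iff_finiteType.mp hAmfg
  haveI hmax : (centreIdeal Am O hAmO).IsMaximal :=
    isMaximal_centreIdeal_of_residuallyAlgebraic O Am hAmO hres
  have h1 : ((centreIdeal Am O hAmO).height : WithBot ℕ∞) = ringKrullDim ↥Am :=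
    height_eq_ringKrullDim_of_isMaximal k (centreIdeal Am O hAmO)
  -- `dim Am = dim A` (both `= tr.deg_k K`)
  haveI : Algebra.FiniteType k ↥A := A.fg_iff_finiteType.mp hA
  haveI : IsFractionRing ↥Am K := isFractionRing_subalgebra_of_le A Am hAAm
  obtain ⟨dA, hdA, htA⟩ := exists_ringKrullDim_eq_and_trdeg_eq k ↥A
  obtain ⟨dM, hdM, htM⟩ := exists_ringKrullDim_eq_and_trdeg_eq k ↥Am
  have hAM : dA = dM := by
    have h : (dA : Cardinal) = dM := by
      rw [← htA, ← htM, ← trdeg_eq_trdeg_of_isFractionRing A, ← trdeg_eq_trdeg_of_isFractionRing Am]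
    exact_mod_cast h
  change ((centreIdeal Am O hAmO).height : WithBot ℕ∞) = ringKrullDim ↥A
  rw [h1, hdM, hdA, hAM]

end Summit.ResolutionOfSingularities.ResolutionOfSingularities.Theorems.NoZeno.Birth

end
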